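import Summits.Ventures.HSemireg.Pad4TowerBandMeasure

/-!
# PAD-4 on 𝔅(μ₄): the BAND BOX LAW, part 2 — `16 · N(s) = W(s)`, `μ = ⟨2(M₀ − W(0)), 2(M₀ − W(e₀))⟩` for EVERY integer (A1)-clean
# axial design, the lattice `μ ∈ 16(1+i)·ℤ[i]` for even band defects, and every `◇_h` design with `h` even
# (HSemireg support file; phase-torus line, «control» lens g6 CYCLE LINE #2 «BAND BOX LAW», module 2 of 2)

Crux of record: `Summit.HodgeConjecture.HodgeConjecture.Theses.EightfoldBlochSeeds.BlochSeedDiscOne`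
(= `HasHyperbolicBlochSeed 4 1`, item stmt-HodgeConjecture-18881; skeleton `Lines/birth.lean`, STUB R `stub_rung_pad4_seedAt`,
named technique = PAD-4 two-level ⊕-block design with a TWO-TERM line-bundle presentation).
Nothing in this file proves HC, HC_AV, HC_CM, H2 or item 18881; census-neutral (no SAT∕UNSAT row is added or changed).

WHAT THIS FILE IS (tree copy of §2d–§2f of the crux workfile `Cruxes/BlochSeedDiscOne/BandPhaseTorusBoxLaw.lean` e5e8b2d03c640a2f, author
plan-lens-HodgeAV-control g6, statements verbatim; memo `Cruxes/BlochSeedDiscOne/BOX-LAW-g6.md` §9 + table `ctl/boxlaw-band-table.md` 16∕16;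
director-hodge word «K-BAND16»):
* §2d box masses of the smeared measure: `16 · N(s) = W(s)`, the signed count `W(s) = Σ ν ∏_f (2 b_f [τ_f ∈ {s_f, s_f+1}] + d_f)`
  (`pairI`, `W`, **`omegaB_boxSum`**);
* §2e **`axialDesign_mu_eq`** — `μ = ⟨2 (M₀ − W(0)), 2 (M₀ − W(e₀))⟩` for every integer (A1)-clean AXIAL design (line or band, any height,
  rank, door, multiplicities, signs; no presentation, no flow), from `PhaseTorus.boxSumLaw'`; **`axialDesign_mu_dvd`** — if every band defect
  is EVEN: `16 ∣ re μ`, `16 ∣ im μ`, `32 ∣ re μ − im μ` (i.e. `μ ∈ 16(1+i)·ℤ[i]`) and `8 ∣ M₀` (`sixteen_dvd_W`, `two_mass_eq`);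
* §2f the diamond: letters of `◇_h` are axial (`axis_of_inDiamond`), band defects are even when `h` is even (`defect_even_of_inDiamond`),
  hence **`diamondDesign_mu_dvd`** for every integer (A1)-clean design supported in `◇_h`, `h` even.
On the LINE (`d_f = 0`, `M₀ = 0` by the Ψ-row) this is `Pad4TowerLineBoxLaw.lineDesign_mu_eq_boxCounts` (`μ ∈ 32ℤ[i]`) again.
Everything here is PROVED (axioms `propext`, `Classical.choice`, `Quot.sound`; no `sorry`, no named fact, no instance, no notation).

WHAT IT IS NOT: a statement about sheaves, monads, a SOURCE or a SEED; the stronger alphabet-free `μ ∈ 32ℤ[i]` for parity-axial designs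
is `Pad4TowerHalfSumLattice.parityAxialDesign_mu_dvd` (this file's `16(1+i)ℤ[i]` is its honest band-box special case, kept as stated).
Tree filing: hsemireg-phasetorus-typer-1 g2.
-/

namespace Summit.Ventures.HSemireg.BandPhaseTorus

open Finset BigOperators Summit.Ventures.HSemireg Summit.Ventures.HSemireg.Pad4Tower
open Summit.Ventures.HSemireg.LinePhaseTorus (lineCharge betaG mletter wordOf tau phaseOf unitG TopWord lineLetter LineCell)

/-! ## §2d box masses of the smeared measure: `16 · N(s) = W(s)` -/

/-- the indicator of the phase pair `{s, s+1}`. -/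
def pairI (s u : ZMod 4) : ℤ := if u = s ∨ u = s + 1 then 1 else 0

/-- `W(s) = Σ ν ∏_f (2 b_f [τ_f ∈ {s_f, s_f+1}] + d_f)` — an INTEGER for an integer design. -/
def W (h : ℤ) (C : MConfig) (mN mP : MCell → ℤ) (s : Fin 4 → ZMod 4) : ℤ :=
  (∑ Z ∈ C.lower, mN Z * ∏ f, (2 * babs Z f * pairI (s f) (tau Z f) + defect h Z f)) -
    ∑ P ∈ C.upper, mP P * ∏ f, (2 * babs P f * pairI (s f) (tau P f) + defect h P f)

/-- one factor's smeared weight summed over an adjacent pair: `2 b_f [τ_f ∈ {s, s+1}] + d_f`, halved conventions as in `W`. -/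
theorem wt_pair_sum {h : ℤ} (Z : MCell) (f : Fin 4) (s : ZMod 4) :
    wt h Z f s + wt h Z f (s + 1) = ((2 * babs Z f * pairI s (tau Z f) + defect h Z f : ℤ) : ℝ) / 2 := by
  unfold wt pairI
  have hne : s + 1 ≠ s := by rw [add_comm]; exact PhaseTorus.one_add_ne s
  by_cases h1 : tau Z f = s
  · rw [if_pos h1.symm, if_neg (by rw [h1]; exact hne), if_pos (Or.inl h1)]; push_cast; ring
  · by_cases h2 : tau Z f = s + 1
    · rw [if_neg (Ne.symm h1), if_pos h2.symm, if_pos (Or.inr h2)]; push_cast; ring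
    · rw [if_neg (Ne.symm h1), if_neg (Ne.symm h2), if_neg (not_or.mpr ⟨h1, h2⟩)]; push_cast; ring

/-- a pbox is a product of adjacent pairs. -/
theorem pbox_eq_piFinset (s : Fin 4 → ZMod 4) :
    PhaseTorus.pbox s = Fintype.piFinset fun f => ({s f, s f + 1} : Finset (ZMod 4)) := by
  ext t
  rw [PhaseTorus.mem_pbox, Fintype.mem_piFinset]
  simp only [Finset.mem_insert, Finset.mem_singleton]

/-- Fubini over a box for one cell's product weight. -/
theorem sum_pbox_prod_wt {h : ℤ} (Z : MCell) (s : Fin 4 → ZMod 4) :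
    ∑ t ∈ PhaseTorus.pbox s, ∏ f, wt h Z f (t f) =
      ((∏ f, (2 * babs Z f * pairI (s f) (tau Z f) + defect h Z f) : ℤ) : ℝ) / 16 := by
  rw [pbox_eq_piFinset, ← Finset.prod_univ_sum]
  have hf : ∀ f, ∑ u ∈ ({s f, s f + 1} : Finset (ZMod 4)), wt h Z f u =
      ((2 * babs Z f * pairI (s f) (tau Z f) + defect h Z f : ℤ) : ℝ) / 2 := fun f => by
    rw [Finset.sum_pair (show s f ≠ s f + 1 from fun h => PhaseTorus.one_add_ne (s f) (by rw [add_comm]; exact h.symm)), wt_pair_sum]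
  simp_rw [hf]
  rw [Finset.prod_div_distrib, Finset.prod_const, Finset.card_univ, Fintype.card_fin]
  push_cast
  norm_num

/-- **box masses**: `16 · boxSum ω̃ s = W(s)`. -/
theorem omegaB_boxSum (h : ℤ) (C : MConfig) (mN mP : MCell → ℤ) (s : Fin 4 → ZMod 4) :
    16 * PhaseTorus.boxSum (omegaB h C mN mP) s = (W h C mN mP s : ℝ) := by
  unfold PhaseTorus.boxSum omegaB W
  rw [Finset.sum_sub_distrib, Finset.sum_comm, Finset.sum_comm (s := PhaseTorus.pbox s) (t := C.upper)]
  simp_rw [← Finset.mul_sum, sum_pbox_prod_wt]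
  push_cast
  rw [mul_sub, Finset.mul_sum, Finset.mul_sum]
  congr 1 <;> refine Finset.sum_congr rfl fun x _ => ?_ <;> ring

/-! ## §2e THE BAND BOX LAW at design level and the lattice `16(1+i)ℤ[i]` -/

/-- **BAND BOX LAW**: `μ = ⟨2(M₀ − W(0)), 2(M₀ − W(e₀))⟩` for every integer (A1)-clean AXIAL design
(any alphabet — line or band —, height, support, rank, multiplicities, signs; no flow, no Hall, no orbit-constancy). -/
theorem axialDesign_mu_eq (h : ℤ) (C : MConfig) (mN mP : MCell → ℤ)
    (hax : ∀ Z ∈ C.lower ∪ C.upper, AxCell Z) (hA1 : ClassScreen (C.wch mN mP)) :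
    C.wch mN mP eWord =
      ⟨2 * (mass h C mN mP - W h C mN mP 0), 2 * (mass h C mN mP - W h C mN mP (Pi.single 0 1))⟩ := by
  set ω := omegaB h C mN mP with hω
  have hK : ∀ k, PhaseTorus.KAdm k → k ≠ 0 → PhaseTorus.moment ω k = 0 :=
    fun k hk hk0 => omegaB_clean h C mN mP hax hA1 k hk hk0
  have h0 := PhaseTorus.boxSumLaw' ω hK 0
  have h1 := PhaseTorus.boxSumLaw' ω hK (Pi.single 0 1)
  simp only [Pi.zero_apply, Finset.sum_const_zero, neg_zero, PhaseTorus.e_zero, one_mul] at h0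
  rw [PhaseTorus.sum_single_zero_one, PhaseTorus.e_neg_one] at h1
  rw [omegaB_mass h C mN mP hax, omegaB_top h C mN mP hax] at h0 h1
  have hb0 := omegaB_boxSum h C mN mP 0
  have hb1 := omegaB_boxSum h C mN mP (Pi.single 0 1)
  rw [← hω] at hb0 hb1
  have hre : ((C.wch mN mP eWord : GaussianInt) : ℂ).re = ((C.wch mN mP eWord).re : ℝ) :=
    (GaussianInt.intCast_re _).symm
  have him : ((C.wch mN mP eWord : GaussianInt) : ℂ).im = ((C.wch mN mP eWord).im : ℝ) :=
    (GaussianInt.intCast_im _).symm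
  have h1' : 32 * PhaseTorus.boxSum ω (Pi.single 0 1) = 2 * (mass h C mN mP : ℝ) - ((C.wch mN mP eWord).im : ℝ) := by
    rw [h1, ← him]; simp
  rw [hre] at h0
  have eRe : ((C.wch mN mP eWord).re : ℝ) = ((2 * (mass h C mN mP - W h C mN mP 0) : ℤ) : ℝ) := by
    push_cast; linarith
  have eIm : ((C.wch mN mP eWord).im : ℝ) = ((2 * (mass h C mN mP - W h C mN mP (Pi.single 0 1)) : ℤ) : ℝ) := by
    push_cast; linarith
  exact Zsqrtd.ext (by exact_mod_cast eRe) (by exact_mod_cast eIm)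

/-- evenness of every factor makes a fourfold product divisible by `16`. -/
theorem sixteen_dvd_prod4 (g : Fin 4 → ℤ) (hg : ∀ f, 2 ∣ g f) : (16 : ℤ) ∣ ∏ f, g f := by
  rw [Fin.prod_univ_four, show (16 : ℤ) = 2 * 2 * 2 * 2 by norm_num]
  exact mul_dvd_mul (mul_dvd_mul (mul_dvd_mul (hg 0) (hg 1)) (hg 2)) (hg 3)

/-- even band defects ⇒ `16 ∣ W(s)`. -/
theorem sixteen_dvd_W (h : ℤ) (C : MConfig) (mN mP : MCell → ℤ)
    (hpar : ∀ Z ∈ C.lower ∪ C.upper, ∀ f, 2 ∣ defect h Z f) (s : Fin 4 → ZMod 4) : (16 : ℤ) ∣ W h C mN mP s := by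
  have hcell : ∀ Z ∈ C.lower ∪ C.upper, (16 : ℤ) ∣ ∏ f, (2 * babs Z f * pairI (s f) (tau Z f) + defect h Z f) :=
    fun Z hZ => sixteen_dvd_prod4 _ fun f => dvd_add (dvd_mul_of_dvd_left (dvd_mul_right 2 (babs Z f)) _) (hpar Z hZ f)
  unfold W
  refine dvd_sub (Finset.dvd_sum fun Z hZ => ?_) (Finset.dvd_sum fun P hP => ?_)
  · exact (hcell Z (Finset.mem_union_left _ hZ)).mul_left _
  · exact (hcell P (Finset.mem_union_right _ hP)).mul_left _

/-- the class-`2` identity: `2 M₀ = W(0) + W(2e₀)`. -/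
theorem two_mass_eq (h : ℤ) (C : MConfig) (mN mP : MCell → ℤ)
    (hax : ∀ Z ∈ C.lower ∪ C.upper, AxCell Z) (hA1 : ClassScreen (C.wch mN mP)) :
    2 * mass h C mN mP = W h C mN mP 0 + W h C mN mP (Pi.single 0 2) := by
  set ω := omegaB h C mN mP with hω
  have hK : ∀ k, PhaseTorus.KAdm k → k ≠ 0 → PhaseTorus.moment ω k = 0 :=
    fun k hk hk0 => omegaB_clean h C mN mP hax hA1 k hk hk0
  have h0 := PhaseTorus.boxSumLaw' ω hK 0
  have h2 := PhaseTorus.boxSumLaw' ω hK (Pi.single 0 2)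
  simp only [Pi.zero_apply, Finset.sum_const_zero, neg_zero, PhaseTorus.e_zero, one_mul] at h0
  have hs2 : ∑ f, (Pi.single (0 : Fin 4) (2 : ZMod 4) : Fin 4 → ZMod 4) f = 2 := by
    rw [Fin.sum_univ_four]; simp
  rw [hs2, show (-2 : ZMod 4) = 2 from by decide, PhaseTorus.e_two, neg_one_mul, Complex.neg_re] at h2
  rw [omegaB_mass h C mN mP hax] at h0 h2
  have hb0 := omegaB_boxSum h C mN mP 0
  have hb2 := omegaB_boxSum h C mN mP (Pi.single 0 2)
  rw [← hω] at hb0 hb2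
  have e : ((2 * mass h C mN mP : ℤ) : ℝ) = ((W h C mN mP 0 + W h C mN mP (Pi.single 0 2) : ℤ) : ℝ) := by
    push_cast; linarith
  exact_mod_cast e

/-- **THE BAND μ-LATTICE**: with even band defects, `16 ∣ re μ`, `16 ∣ im μ`, `32 ∣ re μ − im μ` (`μ ∈ 16(1+i)·ℤ[i]`) and `8 ∣ M₀`. -/
theorem axialDesign_mu_dvd (h : ℤ) (C : MConfig) (mN mP : MCell → ℤ)
    (hax : ∀ Z ∈ C.lower ∪ C.upper, AxCell Z) (hA1 : ClassScreen (C.wch mN mP))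
    (hpar : ∀ Z ∈ C.lower ∪ C.upper, ∀ f, 2 ∣ defect h Z f) :
    (16 : ℤ) ∣ (C.wch mN mP eWord).re ∧ (16 : ℤ) ∣ (C.wch mN mP eWord).im ∧
      (32 : ℤ) ∣ (C.wch mN mP eWord).re - (C.wch mN mP eWord).im ∧ (8 : ℤ) ∣ mass h C mN mP := by
  have hμ := axialDesign_mu_eq h C mN mP hax hA1
  have hM := two_mass_eq h C mN mP hax hA1
  have w0 := sixteen_dvd_W h C mN mP hpar 0
  have w1 := sixteen_dvd_W h C mN mP hpar (Pi.single 0 1)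
  have w2 := sixteen_dvd_W h C mN mP hpar (Pi.single 0 2)
  have hM8 : (8 : ℤ) ∣ mass h C mN mP := by
    have : (16 : ℤ) ∣ 2 * mass h C mN mP := by rw [hM]; exact dvd_add w0 w2
    omega
  rw [hμ]
  refine ⟨?_, ?_, ?_, hM8⟩
  · show (16 : ℤ) ∣ 2 * (mass h C mN mP - W h C mN mP 0)
    omega
  · show (16 : ℤ) ∣ 2 * (mass h C mN mP - W h C mN mP (Pi.single 0 1))
    omega
  · show (32 : ℤ) ∣ 2 * (mass h C mN mP - W h C mN mP 0) - 2 * (mass h C mN mP - W h C mN mP (Pi.single 0 1))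
    omega

/-! ## §2f the diamond `◇_h`: axial letters, even defects when `h` is even -/

/-- every letter of `◇_h` lies on an axis. -/
theorem axis_of_inDiamond {h : ℤ} {x : BPoint} (hx : InDiamond h x) : x.2.1 = 0 ∨ x.2.2 = 0 := by
  rcases hx.1 with h0 | hax
  · left; exact (Prod.ext_iff.mp h0).1
  · rcases hax with ⟨-, h2⟩ | ⟨h1, -⟩
    · exact Or.inr h2
    · exact Or.inl h1

/-- on an axis the absolute charge is the modulus `babs`. -/
theorem absCharge_eq_babs {Z : MCell} {f : Fin 4} (hx : (Z f).2.1 = 0 ∨ (Z f).2.2 = 0) :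
    absCharge (Z f) = babs Z f := by
  unfold absCharge chargeOf babs
  rcases hx with h0 | h0 <;> rw [h0] <;> simp [abs_neg]

/-- in `◇_h` with `h` even every band defect is even. -/
theorem defect_even_of_inDiamond {h : ℤ} (hh : 2 ∣ h) {Z : MCell} (hZ : MCell.InDiamond h Z) (f : Fin 4) :
    2 ∣ defect h Z f := by
  have hx := hZ f
  have hpar := hx.2.2.1
  rw [absCharge_eq_babs (axis_of_inDiamond hx)] at hpar
  unfold defect lineCharge
  omega

/-- **COROLLARY (◇_h, h even)**: every integer (A1)-clean design supported in `◇_h` has `μ ∈ 16(1+i)·ℤ[i]` and `8 ∣ M₀`. -/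
theorem diamondDesign_mu_dvd (h : ℤ) (hh : 2 ∣ h) (C : MConfig) (mN mP : MCell → ℤ)
    (hC : MConfig.InDiamond h C) (hA1 : ClassScreen (C.wch mN mP)) :
    (16 : ℤ) ∣ (C.wch mN mP eWord).re ∧ (16 : ℤ) ∣ (C.wch mN mP eWord).im ∧
      (32 : ℤ) ∣ (C.wch mN mP eWord).re - (C.wch mN mP eWord).im ∧ (8 : ℤ) ∣ mass h C mN mP := by
  have hD : ∀ Z ∈ C.lower ∪ C.upper, MCell.InDiamond h Z := fun Z hZ => by
    rcases Finset.mem_union.mp hZ with hZ | hZ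
    · exact hC.1 Z hZ
    · exact hC.2 Z hZ
  exact axialDesign_mu_dvd h C mN mP (fun Z hZ => axCell_of_axis fun f => axis_of_inDiamond (hD Z hZ f)) hA1
    fun Z hZ f => defect_even_of_inDiamond hh (hD Z hZ) f

end Summit.Ventures.HSemireg.BandPhaseTorus
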